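import Literature.MathematicalPhysics.QuantumLattice.HubbardPseudospinIsotropy
import Literature.MathematicalPhysics.QuantumLattice.HubbardUniformDensityGibbs
import Literature.MathematicalPhysics.QuantumLattice.HubbardKuboKishiBounds
import HarnessLib

/-!
# Pseudospin isotropy at positive temperature: the CDW and `s`-wave pair structure factors of the
# half-filled Hubbard model coincide in the grand-canonical Gibbs state (Zhang 1990)

Topic `Literature/MathematicalPhysics/QuantumLattice` (family `hubbard`). Everything here is PROVED — no
definitions, no named facts, no `sorry`. It is the positive-temperature companion of
`HubbardPseudospinIsotropy` (which draws the consequences of the pseudospin `SU(2)` symmetry for the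
two-point functions of a pseudospin SINGLET vector, i.e. of THE half-filled ground state). Here the state
is the grand-canonical Gibbs state `⟨A⟩_β = tr(e^{-βK} A)/tr e^{-βK}` (`Matrix.gibbsState`) of ANY `K`
commuting with Yang's `η†_ε = Σ_x ε_x c†_{x↑} c†_{x↓}` (`etaRaise ε`) — in particular of the Hubbard
Hamiltonian `K = H(t,U) - (U/2) N` (`hamiltonianWith G t U (U/2)`) on a finite graph `G` with a bipartite
sign `ε` (`ε_x = -ε_y` along every bond), at every temperature and every real `t`, `U`.

Notation: `Δ†_x = c†_{x↑} c†_{x↓}`, `Δ_y = c_{y↓} c_{y↑}`, `n_x - 1 = n_{x↑} + n_{x↓} - 1 = 2 J^z_x`,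
`D_x = n_{x↑} n_{x↓} = Δ†_x Δ_x`, the charge field `F_a = Σ_x a_x (n_x - 1)` (`chargeDensityField a`), the
staggered charge (CDW) field `F_ε`, `F_1 = N - |Λ| = 2 η^z`, and the uniform on-site pair field
`B = Σ_x Δ_x = η_1` (`etaLower 1`; Shastry's `uniformOnSitePair`, `= (etaRaise 1)ᴴ` by
`uniformOnSitePair_eq_conjTranspose_etaRaise`), so that `B† B = η†_1 η_1 = Σ_{x,y} Δ†_x Δ_y` is the
`q = 0` `s`-wave (on-site) pair structure factor times `|Λ|`.

## What is proved

* §1 the key commutator of `HubbardPseudospinIsotropy` §2 as an OPERATOR identity,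
  `[η†_ε, (n_x - 1) Δ_y] = -2 ε_x Δ†_x Δ_y + ε_y (n_x - 1)(n_y - 1)` for `x ≠ y`
  (`etaRaise_commutator_chargeDev_pairAnnihilation_eq`), and `[η†_ε, H(t,U) - (U/2)N] = 0` for a
  bipartite sign (`etaRaise_mul_hamiltonianWith_half`, from Yang's `[H, η†] = U η†` and `[N, η†] = 2η†`);
* §2 a Gibbs state annihilates commutators with conserved quantities, `⟨[Q, A]⟩_{β,K} = 0` if `QK = KQ`
  (`gibbsState_commutator_eq_zero_of_commute`; Bratteli–Robinson II §5.3.1);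
* §3 **thermal pseudospin isotropy** (Zhang): if `η†_ε K = K η†_ε` then for all `x ≠ y` and every `β`
  `⟨(n_x - 1)(n_y - 1)⟩_{β,K} = 2 ε_x ε_y ⟨Δ†_x Δ_y⟩_{β,K}`
  (`gibbsState_chargeDev_mul_chargeDev_eq_of_commute`) — the `zz` and `+-` components of the
  pseudospin–pseudospin correlator agree in every `η`-invariant Gibbs state, exactly as in a pseudospin
  singlet (Xiang–Wu eqs. (13.51)–(13.52): at half filling the CDW and `s`-wave pairing correlations are
  degenerate, at every temperature);
* §4 the operator bookkeeping `η†_1 η_1 = Σ_{x,y} Δ†_x Δ_y`, `F_a F_b = Σ_{x,y} a_x b_y (n_x - 1)(n_y - 1)`,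
  `(n_x - 1)² = 2 D_x - (n_x - 1)`;
* §5 the **summed identity** `⟨F_ε²⟩_{β,K} = 2 ⟨η†_1 η_1⟩_{β,K} - ⟨F_1⟩_{β,K}` for every `K` commuting with
  `η†_ε` (`gibbsState_staggeredCharge_sq_eq_of_commute`): the staggered charge structure factor is twice
  the uniform on-site pair structure factor up to the mean charge deviation `⟨N - |Λ|⟩`;
* §6 the half-filled Hubbard model: for `K = H(t,U) - (U/2)N` with bipartite `ε`, `⟨N⟩_β = |Λ|`
  (Lieb–Loss–McCann, tree `hubbard_gibbsState_totalNumber_halfFilling`), hence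
  `⟨F_ε²⟩_β = 2 ⟨η†_1 η_1⟩_β = 2 ⟨B† B⟩_β` exactly (`hubbard_gibbsState_staggeredCharge_sq_eq_two_mul_pair`,
  real-part form `hubbard_re_gibbsState_pair_eq_half_staggeredCharge_sq`), and the site-resolved isotropy
  (`hubbard_gibbsState_chargeDev_mul_chargeDev_eq`);
* §7 the same on the even torus `(ℤ/Lℤ)^d` with Yang's staggering `torusStagger` (`hubbardTorus_…`).

## Use and honest scope

Consequence for the tree: every CEILING on the thermal staggered charge structure factor `⟨F_ε²⟩_β` of the
half-filled repulsive model (Kubo–Kishi's Gaussian domination `kuboKishi_charge_falkBruch_le`, KK90 Thm 2 /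
Remark 3, and its Mott-window sharpening under `Summits/HubbardSuperconductivity/HubbardLadder/Bounds/`) is
at once a ceiling on the uniform `s`-wave pair structure factor, `⟨B†B⟩_β = ½ ⟨F_ε²⟩_β` — the "pseudospin
symmetry" step that the docstring of `kuboKishi_charge_falkBruch_le_torus` and Kubo–Kishi's Remark 3 take
for granted is here a theorem. Everything is restricted to `μ = U/2` (half filling on average) and bipartite
hopping, where the `η`-symmetry is exact; no decay information; nothing here bears on d-wave pairing or on
the doped model.

References: S.-C. Zhang, Phys. Rev. Lett. 65 (1990) 120 [Zhang1990]; C. N. Yang, Phys. Rev. Lett. 63 (1989)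
2144, eqs. (4), (6) [Yang1989]; C. N. Yang, S.-C. Zhang, Mod. Phys. Lett. B 4 (1990) 759, Theorem 1
[YangZhang1990]; K. Kubo, T. Kishi, Phys. Rev. B 41 (1990) 4866, Theorem 2 and Remark 3 [KuboKishi1990];
E. H. Lieb, M. Loss, R. J. McCann, J. Math. Phys. 34 (1993) 891, Theorem eq. (5) [LiebLossMccann1993];
O. Bratteli, D. W. Robinson, *Operator Algebras and Quantum Statistical Mechanics 2* (Springer 1997) §5.3.1
[BratteliRobinsonII1997]; T. Xiang, C. Wu, *D-wave Superconductivity* (CUP 2022) §13.4 eqs. (13.47)–(13.52)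
[XiangWu2022]; B. S. Shastry, J. Phys. A 30 (1997) L635 [Shastry1997] (the field `B`).
-/

namespace Literature.MathematicalPhysics.QuantumLattice

open Matrix Finset
open scoped ComplexOrder

section General

variable {Λ : Type*} [LinearOrder Λ] [Fintype Λ]

/-! ### §1 The key commutator as an operator identity; `[η†_ε, H - (U/2)N] = 0` -/

/-- **Key commutator, operator form.** For `x ≠ y`,
`η†_ε (n_x - 1) Δ_y - (n_x - 1) Δ_y η†_ε = -2 ε_x Δ†_x Δ_y + ε_y (n_x - 1)(n_y - 1)` as matrices on Fock
space (the vector identity `etaRaise_commutator_chargeDev_pairAnnihilation` holds for every vector).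
[cite: Zhang1990] [cite: YangZhang1990, Theorem 1] -/
theorem etaRaise_commutator_chargeDev_pairAnnihilation_eq {x y : Λ} (hxy : x ≠ y) (ε : Λ → ℤˣ) :
    etaRaise ε * ((numberOp x 0 + numberOp x 1 - 1) * (annihilation (orb y 1) * annihilation (orb y 0))) -
        (numberOp x 0 + numberOp x 1 - 1) * (annihilation (orb y 1) * annihilation (orb y 0)) *
          etaRaise ε =
      -((2 * ((ε x : ℤ) : ℂ)) • (creation (orb x 0) * creation (orb x 1) *
          (annihilation (orb y 1) * annihilation (orb y 0)))) +
        ((ε y : ℤ) : ℂ) • ((numberOp x 0 + numberOp x 1 - 1) * (numberOp y 0 + numberOp y 1 - 1)) := by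
  refine Matrix.ext_iff_mulVec.2 fun f => ?_
  have h := etaRaise_commutator_chargeDev_pairAnnihilation hxy ε f
  simp only [mulVec_mulVec] at h
  rw [sub_mulVec, add_mulVec, neg_mulVec, smul_mulVec, smul_mulVec]
  simpa only [Matrix.mul_assoc] using h

variable (G : SimpleGraph Λ) [DecidableRel G.Adj]

/-- **`[η†_ε, H(t,U) - (U/2) N] = 0` on a bipartite-signed graph** (`ε_x = -ε_y` along every bond): Yang's
`[H(t,U), η†_ε] = U η†_ε` (`hamiltonian_commutator_etaRaise`) and `[N, η†_ε] = 2 η†_ε`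
(`totalNumber_commutator_etaRaise_holds`) cancel at chemical potential `μ = U/2`, so the pseudospin
raising operator is an exact symmetry of the half-filled grand-canonical Hamiltonian.
[cite: Yang1989, eq. (6)] [cite: Zhang1990] -/
theorem etaRaise_mul_hamiltonianWith_half (ε : Λ → ℤˣ) (hε : ∀ x y, G.Adj x y → ε x = -ε y) (t U : ℝ) :
    etaRaise ε * hamiltonianWith G t U (U / 2) = hamiltonianWith G t U (U / 2) * etaRaise ε := by
  have h1 : hamiltonian G t U * etaRaise ε = etaRaise ε * hamiltonian G t U + (U : ℂ) • etaRaise ε := by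
    rw [← hamiltonian_commutator_etaRaise G ε hε t U]; abel
  have h2 : (totalNumber : Matrix (Finset (Orb Λ)) (Finset (Orb Λ)) ℂ) * etaRaise ε =
      etaRaise ε * totalNumber + (2 : ℂ) • etaRaise ε := by
    rw [← totalNumber_commutator_etaRaise_holds ε]; abel
  have hc : ((U / 2 : ℝ) : ℂ) * 2 = (U : ℂ) := by push_cast; ring
  rw [hamiltonianWith_eq, mul_sub, sub_mul, mul_smul_comm, smul_mul_assoc, h1, h2, smul_add, smul_smul, hc]
  abel

end General

/-! ### §2 Gibbs states annihilate commutators with conserved quantities -/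

section Gibbs

variable {m : Type*} [Fintype m] [DecidableEq m]

/-- `⟨Q A - A Q⟩_{β,K} = 0` whenever `Q K = K Q` (cyclicity of the trace and `[Q, e^{-βK}] = 0`, i.e.
`gibbsState_mul_comm_of_commute`; Bratteli–Robinson II §5.3.1, the finite-volume Gibbs state is
invariant under the symmetries of `K`). [cite: BratteliRobinsonII1997, §5.3.1] -/
theorem gibbsState_commutator_eq_zero_of_commute (β : ℝ) {K Q : Matrix m m ℂ} (hQ : Q * K = K * Q)
    (A : Matrix m m ℂ) : gibbsState β K (Q * A - A * Q) = 0 := by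
  rw [map_sub, gibbsState_mul_comm_of_commute β hQ A, sub_self]

end Gibbs

section General

variable {Λ : Type*} [LinearOrder Λ] [Fintype Λ]

/-- `ε_y ε_y = 1` in `ℂ` for a sign `ε_y ∈ ℤˣ`. [folklore] -/
private theorem units_intCast_mul_self (u : ℤˣ) : ((u : ℤ) : ℂ) * ((u : ℤ) : ℂ) = 1 := by
  rcases Int.units_eq_one_or u with h | h <;> simp [h]

/-! ### §3 Thermal pseudospin isotropy (Zhang) -/

/-- **Pseudospin isotropy of the density–density and on-site-pair correlators at positive temperature.**
If `K` commutes with `η†_ε` (e.g. `K = H(t,U) - (U/2)N` on a bipartite-signed graph,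
`etaRaise_mul_hamiltonianWith_half`), then in the Gibbs state of `K` at every inverse temperature `β`,
for all `x ≠ y`, `⟨(n_x - 1)(n_y - 1)⟩_β = 2 ε_x ε_y ⟨c†_{x↑} c†_{x↓} c_{y↓} c_{y↑}⟩_β`: the charge
correlation function equals twice the staggered on-site pair correlation function — the `η`-`SU(2)`
rotation maps the charge-density-wave operator onto the `s`-wave pairing operator, and an `η`-invariant
Gibbs state does not distinguish them (expectation of the key commutator
`etaRaise_commutator_chargeDev_pairAnnihilation_eq` vanishes by `gibbsState_commutator_eq_zero_of_commute`,
and `ε_y² = 1`). [cite: Zhang1990] [cite: YangZhang1990, Theorem 1]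
[cite: XiangWu2022, §13.4 eqs. (13.51)–(13.52)] -/
theorem gibbsState_chargeDev_mul_chargeDev_eq_of_commute {x y : Λ} (hxy : x ≠ y) (ε : Λ → ℤˣ) (β : ℝ)
    {K : Matrix (Finset (Orb Λ)) (Finset (Orb Λ)) ℂ} (hK : etaRaise ε * K = K * etaRaise ε) :
    gibbsState β K ((numberOp x 0 + numberOp x 1 - 1) * (numberOp y 0 + numberOp y 1 - 1)) =
      2 * (((ε x : ℤ) : ℂ) * ((ε y : ℤ) : ℂ)) *
        gibbsState β K (creation (orb x 0) * creation (orb x 1) *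
          (annihilation (orb y 1) * annihilation (orb y 0))) := by
  have h0 := gibbsState_commutator_eq_zero_of_commute β hK
    ((numberOp x 0 + numberOp x 1 - 1) * (annihilation (orb y 1) * annihilation (orb y 0)))
  rw [etaRaise_commutator_chargeDev_pairAnnihilation_eq hxy ε, map_add, map_neg, map_smul, map_smul,
    smul_eq_mul, smul_eq_mul] at h0
  have hy := units_intCast_mul_self (ε y)
  linear_combination ((ε y : ℤ) : ℂ) * h0 -
    (gibbsState β K ((numberOp x 0 + numberOp x 1 - 1) * (numberOp y 0 + numberOp y 1 - 1))) * hy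

/-! ### §4 Operator bookkeeping: `η†_1 η_1`, `F_a F_b`, `(n_x - 1)²` -/

/-- `η†_1 η_1 = B† B = Σ_{x,y} Δ†_x Δ_y` for the CONSTANT sign `ε ≡ 1` (the uniform, `q = 0`, on-site pair
structure factor operator; `B = Σ_x c_{x↓} c_{x↑}` is Shastry's `uniformOnSitePair`). [cite: Yang1989, eq. (4)]
[cite: Shastry1997, eq. (1)] -/
theorem etaRaise_one_mul_etaLower_one :
    etaRaise (fun _ : Λ => (1 : ℤˣ)) * etaLower (fun _ => 1) =
      ∑ x : Λ, ∑ y : Λ, creation (orb x 0) * creation (orb x 1) *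
        (annihilation (orb y 1) * annihilation (orb y 0)) := by
  rw [etaRaise_mul_etaLower_eq_sum]
  simp only [Units.val_one, Int.cast_one, mul_one, one_smul]

/-- `F_a F_b = Σ_{x,y} a_x b_y (n_x - 1)(n_y - 1)` for the charge fields `F_a = Σ_x a_x (n_x - 1)`.
[cite: KuboKishi1990, Theorem 2 and Remark 2] -/
theorem chargeDensityField_mul_chargeDensityField (a b : Λ → ℝ) :
    chargeDensityField a * chargeDensityField b =
      ∑ x : Λ, ∑ y : Λ, ((a x : ℂ) * (b y : ℂ)) •
        ((numberOp x 0 + numberOp x 1 - 1) * (numberOp y 0 + numberOp y 1 - 1)) := by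
  unfold chargeDensityField
  rw [Finset.sum_mul_sum]
  refine Finset.sum_congr rfl fun x _ => Finset.sum_congr rfl fun y _ => ?_
  rw [smul_mul_assoc, mul_smul_comm, smul_smul]

/-- `(n_x - 1)² = 2 D_x - (n_x - 1)` with `D_x = n_{x↑} n_{x↓} = Δ†_x Δ_x` (`n_{xσ}² = n_{xσ}`,
`pairCreation_mul_pairAnnihilation_self`): the on-site (`x = y`) term of both structure factors.
[cite: Yang1989, eq. (4)] -/
theorem chargeDev_mul_chargeDev_self (x : Λ) :
    (numberOp x 0 + numberOp x 1 - 1) * (numberOp x 0 + numberOp x 1 - 1) =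
      (2 : ℂ) • (creation (orb x 0) * creation (orb x 1) * (annihilation (orb x 1) * annihilation (orb x 0))) -
        (numberOp x 0 + numberOp x 1 - 1 : Matrix (Finset (Orb Λ)) (Finset (Orb Λ)) ℂ) := by
  rw [pairCreation_mul_pairAnnihilation_self]
  have h0 : numberOp x 0 * numberOp x 0 = (numberOp x 0 : Matrix (Finset (Orb Λ)) (Finset (Orb Λ)) ℂ) :=
    (numberAt_idempotent (orb x 0)).eq
  have h1 : numberOp x 1 * numberOp x 1 = (numberOp x 1 : Matrix (Finset (Orb Λ)) (Finset (Orb Λ)) ℂ) :=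
    (numberAt_idempotent (orb x 1)).eq
  have hc : numberOp x 1 * numberOp x 0 = (numberOp x 0 * numberOp x 1 : Matrix (Finset (Orb Λ)) (Finset (Orb Λ)) ℂ) :=
    (numberAt_commute (orb x 1) (orb x 0)).eq
  rw [sub_mul, one_mul, mul_sub, mul_one, add_mul, mul_add, mul_add, h0, h1, hc, two_smul]
  abel

/-! ### §5 The summed identity `⟨F_ε²⟩ = 2⟨η†_1 η_1⟩ - ⟨F_1⟩` in every `η†_ε`-invariant Gibbs state -/

/-- **CDW structure factor = twice the uniform `s`-wave pair structure factor, up to `⟨N - |Λ|⟩`.** If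
`η†_ε K = K η†_ε` then at every `β`,
`⟨F_ε F_ε⟩_{β,K} = 2 ⟨η†_1 η_1⟩_{β,K} - ⟨F_1⟩_{β,K}`, where `F_ε = Σ_x ε_x (n_x - 1)` is the staggered
charge field, `η†_1 η_1 = Σ_{x,y} Δ†_x Δ_y = B†B` the uniform on-site pair structure factor and
`F_1 = Σ_x (n_x - 1) = N - |Λ|`. (Off-diagonal terms: the thermal isotropy
`gibbsState_chargeDev_mul_chargeDev_eq_of_commute` times `ε_x ε_y`, `ε² = 1`; diagonal terms:
`(n_x - 1)² = 2 Δ†_x Δ_x - (n_x - 1)`.) In pseudospin language: `4⟨(J̃^z)²⟩ = 2⟨J̃^+ J̃^-⟩ - 2⟨J^z⟩` for the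
staggered pseudospin `J̃ = Σ_x ε_x J_x` rotated by the `η`-`SU(2)`. [cite: Zhang1990]
[cite: YangZhang1990, Theorem 1] [cite: KuboKishi1990, Remark 3] -/
theorem gibbsState_staggeredCharge_sq_eq_of_commute (ε : Λ → ℤˣ) (β : ℝ)
    {K : Matrix (Finset (Orb Λ)) (Finset (Orb Λ)) ℂ} (hK : etaRaise ε * K = K * etaRaise ε) :
    gibbsState β K (chargeDensityField (fun x => ((ε x : ℤ) : ℝ)) *
        chargeDensityField fun x => ((ε x : ℤ) : ℝ)) =
      2 * gibbsState β K (etaRaise (fun _ : Λ => (1 : ℤˣ)) * etaLower (fun _ => 1)) -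
        gibbsState β K (chargeDensityField fun _ => (1 : ℝ)) := by
  -- abbreviations: `P x y = Δ†_x Δ_y`, `C x = n_x - 1`
  set P : Λ → Λ → Matrix (Finset (Orb Λ)) (Finset (Orb Λ)) ℂ := fun x y =>
    creation (orb x 0) * creation (orb x 1) * (annihilation (orb y 1) * annihilation (orb y 0)) with hP
  set C : Λ → Matrix (Finset (Orb Λ)) (Finset (Orb Λ)) ℂ := fun x => numberOp x 0 + numberOp x 1 - 1
    with hC
  -- the site-resolved identity, diagonal and off-diagonal
  have key : ∀ x y : Λ, ((ε x : ℤ) : ℂ) * ((ε y : ℤ) : ℂ) * gibbsState β K (C x * C y) =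
      2 * gibbsState β K (P x y) - if x = y then gibbsState β K (C x) else 0 := by
    intro x y
    by_cases hxy : x = y
    · subst hxy
      rw [if_pos rfl, units_intCast_mul_self, one_mul, hC, hP]
      dsimp only
      rw [chargeDev_mul_chargeDev_self, map_sub, map_smul, smul_eq_mul]
    · rw [if_neg hxy, sub_zero, hC, hP]
      dsimp only
      rw [gibbsState_chargeDev_mul_chargeDev_eq_of_commute hxy ε β hK]
      have hx := units_intCast_mul_self (ε x)
      have hy := units_intCast_mul_self (ε y)
      linear_combination (2 * gibbsState β K (creation (orb x 0) * creation (orb x 1) *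
        (annihilation (orb y 1) * annihilation (orb y 0)))) * (((ε y : ℤ) : ℂ) * ((ε y : ℤ) : ℂ) * hx + hy)
  -- the uniform pair structure factor and `F_1` as site sums
  have hpair : gibbsState β K (etaRaise (fun _ : Λ => (1 : ℤˣ)) * etaLower (fun _ => 1)) =
      ∑ x, ∑ y, gibbsState β K (P x y) := by
    rw [etaRaise_one_mul_etaLower_one, map_sum]
    exact Finset.sum_congr rfl fun x _ => by rw [map_sum]
  have hF1 : gibbsState β K (chargeDensityField fun _ => (1 : ℝ)) = ∑ x, gibbsState β K (C x) := by
    unfold chargeDensityField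
    rw [map_sum]
    exact Finset.sum_congr rfl fun x _ => by rw [Complex.ofReal_one, one_smul]
  -- expand `F_ε F_ε` and sum the site-resolved identity
  rw [chargeDensityField_mul_chargeDensityField, map_sum, hpair, hF1, Finset.mul_sum,
    ← Finset.sum_sub_distrib]
  refine Finset.sum_congr rfl fun x _ => ?_
  rw [map_sum, Finset.mul_sum]
  have hx : ∀ y, gibbsState β K ((((((ε x : ℤ) : ℝ) : ℂ)) * (((ε y : ℤ) : ℝ) : ℂ)) • (C x * C y)) =
      2 * gibbsState β K (P x y) - if x = y then gibbsState β K (C x) else 0 := by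
    intro y
    rw [map_smul, smul_eq_mul, Complex.ofReal_intCast, Complex.ofReal_intCast]
    exact key x y
  rw [Finset.sum_congr rfl fun y _ => hx y, Finset.sum_sub_distrib, Finset.sum_ite_eq,
    if_pos (Finset.mem_univ x)]

/-! ### §6 The half-filled Hubbard model `K = H(t,U) - (U/2) N` on a bipartite-signed graph -/

variable (G : SimpleGraph Λ) [DecidableRel G.Adj]

/-- **Thermal pseudospin isotropy for the half-filled Hubbard model** (every finite graph with a bipartite
sign `ε`, all real `t, U`, every `β`): `⟨(n_x - 1)(n_y - 1)⟩_β = 2 ε_x ε_y ⟨Δ†_x Δ_y⟩_β` for `x ≠ y` in the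
Gibbs state of `H(t,U) - (U/2)N`. [cite: Zhang1990] [cite: YangZhang1990, Theorem 1] -/
theorem hubbard_gibbsState_chargeDev_mul_chargeDev_eq (ε : Λ → ℤˣ) (hε : ∀ x y, G.Adj x y → ε x = -ε y)
    (t U β : ℝ) {x y : Λ} (hxy : x ≠ y) :
    gibbsState β (hamiltonianWith G t U (U / 2))
        ((numberOp x 0 + numberOp x 1 - 1) * (numberOp y 0 + numberOp y 1 - 1)) =
      2 * (((ε x : ℤ) : ℂ) * ((ε y : ℤ) : ℂ)) *
        gibbsState β (hamiltonianWith G t U (U / 2)) (creation (orb x 0) * creation (orb x 1) *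
          (annihilation (orb y 1) * annihilation (orb y 0))) :=
  gibbsState_chargeDev_mul_chargeDev_eq_of_commute hxy ε β (etaRaise_mul_hamiltonianWith_half G ε hε t U)

/-- `⟨F_1⟩_β = ⟨N - |Λ|⟩_β = 0` at `μ = U/2`: the grand-canonical Gibbs state of the bipartite-signed Hubbard
model is exactly half filled on average (Lieb–Loss–McCann eq. (5), tree
`hubbard_gibbsState_siteNumber_halfFilling`, and `⟨1⟩_β = 1`). [cite: LiebLossMccann1993, Theorem eq. (5)] -/
theorem hubbard_gibbsState_chargeDensityField_one (ε : Λ → ℤˣ) (hε : ∀ x y, G.Adj x y → ε x = -ε y)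
    (t U β : ℝ) :
    gibbsState β (hamiltonianWith G t U (U / 2)) (chargeDensityField fun _ => (1 : ℝ)) = 0 := by
  have hZ : partitionFn β (hamiltonianWith G t U (U / 2)) ≠ 0 :=
    (partitionFn_pos β (isHermitian_hamiltonianWith G t U (U / 2))).ne'
  unfold chargeDensityField
  rw [map_sum]
  refine Finset.sum_eq_zero fun x _ => ?_
  rw [Complex.ofReal_one, one_smul, map_sub, hubbard_gibbsState_siteNumber_halfFilling G ε hε,
    gibbsState_one β _ hZ, sub_self]

/-- **The CDW structure factor is exactly twice the uniform `s`-wave pair structure factor at half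
filling, at every temperature**: `⟨F_ε F_ε⟩_β = 2 ⟨η†_1 η_1⟩_β = 2 ⟨B† B⟩_β` in the Gibbs state of
`H(t,U) - (U/2)N` on a bipartite-signed graph (all real `t, U`, every `β`).
[cite: Zhang1990] [cite: KuboKishi1990, Remark 3] -/
theorem hubbard_gibbsState_staggeredCharge_sq_eq_two_mul_pair (ε : Λ → ℤˣ)
    (hε : ∀ x y, G.Adj x y → ε x = -ε y) (t U β : ℝ) :
    gibbsState β (hamiltonianWith G t U (U / 2)) (chargeDensityField (fun x => ((ε x : ℤ) : ℝ)) *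
        chargeDensityField fun x => ((ε x : ℤ) : ℝ)) =
      2 * gibbsState β (hamiltonianWith G t U (U / 2))
        (etaRaise (fun _ : Λ => (1 : ℤˣ)) * etaLower (fun _ => 1)) := by
  rw [gibbsState_staggeredCharge_sq_eq_of_commute ε β (etaRaise_mul_hamiltonianWith_half G ε hε t U),
    hubbard_gibbsState_chargeDensityField_one G ε hε, sub_zero]

/-- Real-part form for ceilings: `Re⟨B† B⟩_β = ½ Re⟨F_ε²⟩_β` at half filling, so that every upper bound on
the thermal CDW structure factor (e.g. Kubo–Kishi's `kuboKishi_charge_falkBruch_le`) is an upper bound on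
the uniform on-site pair structure factor with half the constant. [cite: KuboKishi1990, Theorem 2 and Remark 3]
[cite: Zhang1990] -/
theorem hubbard_re_gibbsState_pair_eq_half_staggeredCharge_sq (ε : Λ → ℤˣ)
    (hε : ∀ x y, G.Adj x y → ε x = -ε y) (t U β : ℝ) :
    (gibbsState β (hamiltonianWith G t U (U / 2))
        (etaRaise (fun _ : Λ => (1 : ℤˣ)) * etaLower (fun _ => 1))).re =
      1 / 2 * (gibbsState β (hamiltonianWith G t U (U / 2))
        (chargeDensityField (fun x => ((ε x : ℤ) : ℝ)) * chargeDensityField fun x => ((ε x : ℤ) : ℝ))).re := by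
  have h2 : ∀ z : ℂ, ((2 : ℂ) * z).re = 2 * z.re := fun z => by simp [Complex.mul_re]
  rw [hubbard_gibbsState_staggeredCharge_sq_eq_two_mul_pair G ε hε, h2]
  ring

end General

/-! ### §7 The even torus `(ℤ/Lℤ)^d` with Yang's staggering `ε_x = (-1)^{Σ xᵢ}` -/

section Torus

variable {d L : ℕ}

/-- Thermal pseudospin isotropy on the even torus: for `L` even, every `d`, all real `t, U`, every `β` and
`x ≠ y`, `⟨(n_x - 1)(n_y - 1)⟩_β = 2 ε_x ε_y ⟨Δ†_x Δ_y⟩_β` in the Gibbs state of `hubbardTorusWith d L t U (U/2)`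
(`ε = torusStagger`). [cite: Zhang1990] [cite: YangZhang1990, Theorem 1] -/
theorem hubbardTorus_gibbsState_chargeDev_mul_chargeDev_eq (hL : Even L) (t U β : ℝ)
    {x y : FermionTorus d L} (hxy : x ≠ y) :
    gibbsState β (hubbardTorusWith d L t U (U / 2))
        ((numberOp x 0 + numberOp x 1 - 1) * (numberOp y 0 + numberOp y 1 - 1)) =
      2 * (((torusStagger x : ℤ) : ℂ) * ((torusStagger y : ℤ) : ℂ)) *
        gibbsState β (hubbardTorusWith d L t U (U / 2)) (creation (orb x 0) * creation (orb x 1) *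
          (annihilation (orb y 1) * annihilation (orb y 0))) := by
  have h := hubbard_gibbsState_chargeDev_mul_chargeDev_eq (fermionTorusGraph d L) torusStagger
    (fun _ _ h => torusStagger_eq_neg_of_adj_holds hL h) t U β hxy
  unfold hubbardTorusWith
  convert h

/-- **CDW = 2 × uniform `s`-wave pairing on the even torus at half filling, every temperature**:
`⟨F_Q F_Q⟩_β = 2 ⟨B† B⟩_β` for `hubbardTorusWith d L t U (U/2)`, `L` even, `F_Q = Σ_x (-1)^x (n_x - 1)`,
`B = Σ_x c_{x↓} c_{x↑}` (`B†B = η†_1 η_1`). [cite: Zhang1990] [cite: KuboKishi1990, Remark 3] -/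
theorem hubbardTorus_gibbsState_staggeredCharge_sq_eq_two_mul_pair (hL : Even L) (t U β : ℝ) :
    gibbsState β (hubbardTorusWith d L t U (U / 2))
        (chargeDensityField (fun x => ((torusStagger (d := d) (L := L) x : ℤ) : ℝ)) *
          chargeDensityField fun x => ((torusStagger (d := d) (L := L) x : ℤ) : ℝ)) =
      2 * gibbsState β (hubbardTorusWith d L t U (U / 2))
        (etaRaise (fun _ : FermionTorus d L => (1 : ℤˣ)) * etaLower (fun _ => 1)) := by
  have h := hubbard_gibbsState_staggeredCharge_sq_eq_two_mul_pair (fermionTorusGraph d L) torusStagger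
    (fun _ _ h => torusStagger_eq_neg_of_adj_holds hL h) t U β
  unfold hubbardTorusWith
  convert h

end Torus

end Literature.MathematicalPhysics.QuantumLattice
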